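import Literature.Computability.Cryptography.HallgrenClassGroup
import HarnessLib

/-!
# Stub `stub_cubeHit` of line `Sketch` for the crux `ArithStatLadder.IqThreeNotBPP` (stmt-QuantumAdvantage-14864)

The GOOD seeds of the planted family hit `IQ3 = {d : −d fundamental, 3 ∣ h(−d)}`. For the odd
squarefree part `M` of the input, a length parameter `n` and a seed `j`, put
`U = 6M·2^{3n+32} ± 1` (`−` iff `M ≡ 2 (mod 3)`), `s = 1 + 6MU·j`, `w = 2U³ − M s` and
`m' = M·s·w`; the output of the reduction is `d = 4m'`. Granting the order-`3` certificate
(`u⁶ = x² + n`, `u > 1` odd, `n` squarefree, `n > u²` `⟹ 3 ∣ h(−4n)`; the hypothesis of the stub,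
proved separately as `stub_orderThreeCert`), if `M s ≤ U³` and `s`, `w` are squarefree then
`d ∈ IQ3`.

Proof (elementary). `U` is odd, `> 1` and `≡ ±1 (mod M)`, so `gcd(M, U) = 1`;
`s ≡ 1 (mod 6MU)` is odd and prime to `M` and `U`. Writing `U³ = M s + c`, we get `w = M s + 2c`,
`m' = M s (M s + 2c)` and `U⁶ = c² + m'`. The three squarefree factors `M`, `s`, `M s + 2c` are
pairwise coprime (`c` is prime to `M` and `s` because `U³` is, and `M`, `s` are odd), so `m'` is
squarefree; `m' ≥ M s + 2c ≥ U³ > U²`; hence the certificate gives `3 ∣ h(−4m')`. Finally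
`c = U³ − M s` is even and `M s` is odd, so `m' ≡ (M s)² ≡ 1 (mod 4)`, i.e. `−4m'` is a
fundamental discriminant (`4 ∣ −4m'`, `−m' ≡ 3 (mod 4)`, `−m'` squarefree).
-/

set_option linter.dupNamespace false -- D-0017: single-problem summit ⇒ QuantumAdvantage.QuantumAdvantage by design

namespace Summit.QuantumAdvantage.QuantumAdvantage.Theorems.IqThreeNotBPP

open Literature.Computability.Cryptography (IsNegFundamentalDiscr)
open Literature.NumberTheory.QuadraticFields (BinaryQuadraticForm.classNumber)

/-- If `b ∣ a + 1` then `gcd(a, b) = 1`. [folklore] -/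
private theorem coprime_of_dvd_add_one {a b : ℕ} (h : b ∣ a + 1) : Nat.Coprime a b :=
  (Nat.coprime_self_add_right.2 (Nat.coprime_one_right a)).coprime_dvd_right h

/-- If `b ∣ L` then `gcd(L + 1, b) = 1`. [folklore] -/
private theorem coprime_add_one_of_dvd {L b : ℕ} (h : b ∣ L) : Nat.Coprime (L + 1) b :=
  (Nat.coprime_self_add_left.2 (Nat.coprime_one_left L)).coprime_dvd_right h

/-- An odd number is prime to `2`. [folklore] -/
private theorem coprime_two_of_odd {a : ℕ} (h : Odd a) : Nat.Coprime a 2 := by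
  obtain ⟨k, rfl⟩ := h
  exact coprime_add_one_of_dvd (dvd_mul_right 2 k)

/-- `4m` lies in `IQ3 = {d : −d fundamental, 3 ∣ h(−d)}` as soon as `m ≡ 1 (mod 4)` is squarefree
and `3 ∣ h(−4m)` (the second branch of fundamentality: `4 ∣ −4m`, `−m ≡ 3 (mod 4)`,
`−m` squarefree). [folklore] -/
theorem four_mul_mem_iqThree {m : ℕ} (hm4 : m % 4 = 1) (hsq : Squarefree m)
    (h3 : 3 ∣ BinaryQuadraticForm.classNumber (-(4 * (m : ℤ)))) :
    4 * m ∈ {d : ℕ | IsNegFundamentalDiscr d ∧ 3 ∣ BinaryQuadraticForm.classNumber (-(d : ℤ))} := by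
  refine Set.mem_setOf.mpr ⟨Or.inr ?_, by exact_mod_cast h3⟩
  have h4 : (-((4 * m : ℕ) : ℤ)) / 4 = -(m : ℤ) := by push_cast; omega
  refine ⟨⟨-(m : ℤ), by push_cast; ring⟩, ?_, ?_⟩
  · rw [h4]; omega
  · rw [h4, ← Int.squarefree_natAbs, Int.natAbs_neg, Int.natAbs_natCast]
    exact hsq

/-- The arithmetic core of `stub_cubeHit`, for abstract `U`, `s`: granting the certificate, if
`M`, `s` are odd and squarefree, `U > 1` is odd, `gcd(M, U) = gcd(s, M) = gcd(s, U) = 1`,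
`M s ≤ U³` and `2U³ − M s` is squarefree, then `4 · M s (2U³ − M s) ∈ IQ3`. [folklore] -/
theorem four_mul_mem_iqThree_of_coprime
    (hcert : ∀ u x n : ℕ, Odd u → 1 < u → u ^ 6 = x ^ 2 + n → Squarefree n → u ^ 2 < n →
      3 ∣ BinaryQuadraticForm.classNumber (-(4 * (n : ℤ))))
    {M U s : ℕ} (hM : Odd M) (hMsq : Squarefree M) (hU : Odd U) (hU1 : 1 < U)
    (hMU : Nat.Coprime M U) (hsM : Nat.Coprime s M) (hsU : Nat.Coprime s U) (hsodd : Odd s)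
    (hle : M * s ≤ U ^ 3) (hs : Squarefree s) (hw : Squarefree (2 * U ^ 3 - M * s)) :
    4 * (M * s * (2 * U ^ 3 - M * s)) ∈
      {d : ℕ | IsNegFundamentalDiscr d ∧ 3 ∣ BinaryQuadraticForm.classNumber (-(d : ℤ))} := by
  obtain ⟨c, hc⟩ := Nat.exists_eq_add_of_le hle
  have hw' : 2 * U ^ 3 - M * s = M * s + 2 * c := by omega
  rw [hw'] at hw ⊢
  have key : U ^ 6 = c ^ 2 + M * s * (M * s + 2 * c) := by
    rw [show U ^ 6 = (U ^ 3) ^ 2 by ring, hc]; ring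
  -- pairwise coprimality of the three squarefree factors `M`, `s`, `M s + 2c`
  have hMc : Nat.Coprime M c := by
    have h := hMU.pow_right 3
    rw [hc] at h
    exact (Nat.coprime_mul_left_add_right M c s).1 h
  have hsc : Nat.Coprime s c := by
    have h := hsU.pow_right 3
    rw [hc] at h
    exact (Nat.coprime_mul_right_add_right s c M).1 h
  have hMw : Nat.Coprime M (M * s + 2 * c) :=
    (Nat.coprime_mul_left_add_right M (2 * c) s).2 ((coprime_two_of_odd hM).mul_right hMc)
  have hsw : Nat.Coprime s (M * s + 2 * c) :=
    (Nat.coprime_mul_right_add_right s (2 * c) M).2 ((coprime_two_of_odd hsodd).mul_right hsc)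
  have hsqm : Squarefree (M * s * (M * s + 2 * c)) :=
    (Nat.squarefree_mul (hMw.mul_left hsw)).2 ⟨(Nat.squarefree_mul hsM.symm).2 ⟨hMsq, hs⟩, hw⟩
  -- parities: `M s` is odd, `c` is even, so `m' ≡ 1 (mod 4)`
  obtain ⟨b, hb⟩ : Odd (M * s) := hM.mul hsodd
  obtain ⟨a, ha⟩ : Odd (U ^ 3) := hU.pow
  have hm4 : M * s * (M * s + 2 * c) % 4 = 1 := by
    obtain ⟨c', hc'⟩ : Even c := Nat.even_iff.mpr (by omega)
    have hring :
        (2 * b + 1) * (2 * b + 1 + 2 * (c' + c')) = 4 * (b ^ 2 + b + 2 * b * c' + c') + 1 := by ring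
    rw [hb, hc', hring]
    omega
  -- size: `m' ≥ M s + 2 c ≥ U³ > U²`
  have hlt : U ^ 2 < M * s * (M * s + 2 * c) :=
    calc U ^ 2 < U ^ 3 := Nat.pow_lt_pow_right hU1 (by norm_num)
      _ ≤ M * s + 2 * c := by omega
      _ ≤ M * s * (M * s + 2 * c) := Nat.le_mul_of_pos_left _ (by omega)
  exact four_mul_mem_iqThree hm4 hsqm (hcert U c _ hU hU1 key hsqm hlt)

/-- **Stub `stub_cubeHit`.** Granting the order-`3` certificate (the antecedent), a good seed `j`
of an odd squarefree `M` yields a member of `IQ3`: with `U = 6M·2^{3n+32} ∓ 1`, `s = 1 + 6MU·j`,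
if `M s ≤ U³` and `s`, `2U³ − M s` are squarefree then `4 · M s (2U³ − M s)` is `4m'` with `−4m'`
fundamental and `3 ∣ h(−4m')`. -/
theorem stub_cubeHit :
    (∀ u x n : ℕ, Odd u → 1 < u → u ^ 6 = x ^ 2 + n → Squarefree n → u ^ 2 < n →
      3 ∣ BinaryQuadraticForm.classNumber (-(4 * (n : ℤ)))) →
    ∀ n M j : ℕ, Odd M → Squarefree M →
      let U := if M % 3 = 2 then 6 * M * 2 ^ (3 * n + 32) - 1 else 6 * M * 2 ^ (3 * n + 32) + 1
      let s := 1 + 6 * M * U * j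
      M * s ≤ U ^ 3 → Squarefree s → Squarefree (2 * U ^ 3 - M * s) →
        4 * (M * s * (2 * U ^ 3 - M * s)) ∈
          {d : ℕ | IsNegFundamentalDiscr d ∧ 3 ∣ BinaryQuadraticForm.classNumber (-(d : ℤ))} := by
  intro hcert n M j hM hMsq U s hle hs hw
  obtain ⟨K, hK⟩ : ∃ K, K = 6 * M * 2 ^ (3 * n + 32) := ⟨_, rfl⟩
  have hUdef : U = if M % 3 = 2 then K - 1 else K + 1 := by rw [hK]
  have hsdef : s = 6 * M * U * j + 1 := Nat.add_comm _ _
  clear_value U s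
  -- `K = 6M·2^E` is even, a multiple of `M`, and `≥ 6`
  have hM1 : 1 ≤ M := by obtain ⟨k, rfl⟩ := hM; omega
  have h2K : 2 ∣ K := ⟨3 * M * 2 ^ (3 * n + 32), by rw [hK]; ring⟩
  have hMK : M ∣ K := ⟨6 * 2 ^ (3 * n + 32), by rw [hK]; ring⟩
  have hK6 : 6 ≤ K := by
    have h2 : 1 ≤ 2 ^ (3 * n + 32) := Nat.one_le_two_pow
    rw [hK]; nlinarith
  -- `U = K ∓ 1` is odd, `> 1`, and prime to `M`
  have hUodd : Odd U := by
    refine Nat.odd_iff.mpr ?_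
    split_ifs at hUdef <;> omega
  have hU1 : 1 < U := by split_ifs at hUdef <;> omega
  have hMU : Nat.Coprime M U := by
    split_ifs at hUdef
    · refine (coprime_of_dvd_add_one ?_).symm
      rw [show U + 1 = K by omega]
      exact hMK
    · rw [hUdef]
      exact (coprime_add_one_of_dvd hMK).symm
  -- `s = 6MU·j + 1` is odd and prime to `M` and `U`
  have hsM : Nat.Coprime s M := hsdef ▸ coprime_add_one_of_dvd ⟨6 * U * j, by ring⟩
  have hsU : Nat.Coprime s U := hsdef ▸ coprime_add_one_of_dvd ⟨6 * M * j, by ring⟩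
  have hsodd : Odd s := by
    refine Nat.odd_iff.mpr ?_
    have h2 : 2 ∣ 6 * M * U * j := ⟨3 * M * U * j, by ring⟩
    omega
  exact four_mul_mem_iqThree_of_coprime hcert hM hMsq hUodd hU1 hMU hsM hsU hsodd hle hs hw

end Summit.QuantumAdvantage.QuantumAdvantage.Theorems.IqThreeNotBPP
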